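import Mathlib

/-!
# The one-leg-orthonormal law (`δ = 1/2` regime of `stub_nonnegFlatDecay`)

Line `unit-tensor-orbit-nuclear-ratio` for the crux `FidelityWitnesses.DiagonalPowerDecay`
(`stmt-MatrixMultiplication-14053`).  The open stub `stub_nonnegFlatDecay` asks for
`|⟨S, Y⟩|² ≤ C·|ι|^{3/2-δ}·‖S‖²` for every spectrally flat non-negative target `Y` and every orbit point
`S = (g₁,g₂,g₃)·I_ι = Σ_l g₁(·,l) ⊗ g₂(·,l) ⊗ g₃(·,l)` of the unit tensor.

This file proves the LOW-CANCELLATION case in which ONE leg of the frame is orthonormal (the columns of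
`g₁` form an orthonormal system; `g₂, g₃` arbitrary, `Y` merely flat — non-negativity and invertibility are
not needed): then `|⟨S, Y⟩|² ≤ |ι| · ‖S‖²`, i.e. the stub holds there with `C = 1`, `δ = 1/2`
(`oneLegOrthonormalLaw`, registered sub-goal).  Proof: `⟨S,Y⟩ = Σ_l Y(g₁(·,l), g₂(·,l), g₃(·,l))`
(`oneLeg_overlap_sum`), each term is at most `‖g₂(·,l)‖·‖g₃(·,l)‖` by flatness and `‖g₁(·,l)‖ = 1`;
by orthonormality of the first leg `‖S‖² = Σ_l ‖g₂(·,l)‖²·‖g₃(·,l)‖²` (Parseval, `oneLeg_normSq`); and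
Cauchy–Schwarz over `l` costs exactly the factor `|ι|`.  So all difficulty of the stub sits in frames whose
three legs are simultaneously far from orthogonal (coherent cancelling frames near the boundary of the orbit).
-/

-- the tree's namespace `Summit.MatrixMultiplication.MatrixMultiplication.…` repeats a component by design
set_option linter.dupNamespace false

namespace Summit.MatrixMultiplication.MatrixMultiplication.Theorems.DiagonalPowerDecay

open scoped BigOperators ComplexConjugate

noncomputable section

variable {ι : Type} [Fintype ι]

/-- The overlap of a frame tensor with `Y` is the sum of the triad overlaps:
`Σ_{abc} (Σ_l g₁ a l · g₂ b l · g₃ c l) · Y a b c = Σ_l Σ_{abc} g₁ a l · g₂ b l · g₃ c l · Y a b c`. -/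
theorem oneLeg_overlap_sum (g₁ g₂ g₃ : Matrix ι ι ℂ) (Y : ι → ι → ι → ℂ) :
    (∑ a, ∑ b, ∑ c, (∑ l, g₁ a l * g₂ b l * g₃ c l) * Y a b c) =
      ∑ l, ∑ a, ∑ b, ∑ c, g₁ a l * g₂ b l * g₃ c l * Y a b c := by
  simp only [Finset.sum_mul]
  calc (∑ a, ∑ b, ∑ c, ∑ l, g₁ a l * g₂ b l * g₃ c l * Y a b c)
      = ∑ a, ∑ b, ∑ l, ∑ c, g₁ a l * g₂ b l * g₃ c l * Y a b c :=
        Finset.sum_congr rfl fun a _ => Finset.sum_congr rfl fun b _ => Finset.sum_comm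
    _ = ∑ a, ∑ l, ∑ b, ∑ c, g₁ a l * g₂ b l * g₃ c l * Y a b c :=
        Finset.sum_congr rfl fun a _ => Finset.sum_comm
    _ = ∑ l, ∑ a, ∑ b, ∑ c, g₁ a l * g₂ b l * g₃ c l * Y a b c := Finset.sum_comm

/-- **Parseval for an orthonormal first leg.**  If the columns of `g₁` are orthonormal then
`‖Σ_l g₁(·,l) ⊗ g₂(·,l) ⊗ g₃(·,l)‖² = Σ_l ‖g₂(·,l)‖² · ‖g₃(·,l)‖²`. -/
theorem oneLeg_normSq [DecidableEq ι] (g₁ g₂ g₃ : Matrix ι ι ℂ)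
    (h₁ : ∀ l m : ι, (∑ a, conj (g₁ a l) * g₁ a m) = if l = m then 1 else 0) :
    (∑ a, ∑ b, ∑ c, ‖∑ l, g₁ a l * g₂ b l * g₃ c l‖ ^ 2) =
      ∑ l, (∑ b, ‖g₂ b l‖ ^ 2) * ∑ c, ‖g₃ c l‖ ^ 2 := by
  -- Parseval in the first slot, for fixed `(b, c)`
  have parseval : ∀ z : ι → ℂ, (∑ a, ‖∑ l, g₁ a l * z l‖ ^ 2) = ∑ l, ‖z l‖ ^ 2 := by
    intro z
    apply Complex.ofReal_injective
    push_cast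
    simp_rw [← Complex.conj_mul']
    -- expand the product of sums and use orthonormality
    calc (∑ a, conj (∑ l, g₁ a l * z l) * ∑ m, g₁ a m * z m)
        = ∑ a, ∑ l, ∑ m, conj (z l) * z m * (conj (g₁ a l) * g₁ a m) := by
          refine Finset.sum_congr rfl fun a _ => ?_
          rw [map_sum, Finset.sum_mul_sum]
          exact Finset.sum_congr rfl fun l _ => Finset.sum_congr rfl fun m _ => by
            rw [map_mul]; ring
      _ = ∑ l, ∑ m, conj (z l) * z m * ∑ a, conj (g₁ a l) * g₁ a m := by
          rw [Finset.sum_comm]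
          refine Finset.sum_congr rfl fun l _ => ?_
          rw [Finset.sum_comm]
          exact Finset.sum_congr rfl fun m _ => by rw [Finset.mul_sum]
      _ = ∑ l, conj (z l) * z l := by
          refine Finset.sum_congr rfl fun l _ => ?_
          simp_rw [h₁]
          simp
  calc (∑ a, ∑ b, ∑ c, ‖∑ l, g₁ a l * g₂ b l * g₃ c l‖ ^ 2)
      = ∑ b, ∑ a, ∑ c, ‖∑ l, g₁ a l * g₂ b l * g₃ c l‖ ^ 2 := Finset.sum_comm
    _ = ∑ b, ∑ c, ∑ a, ‖∑ l, g₁ a l * g₂ b l * g₃ c l‖ ^ 2 :=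
        Finset.sum_congr rfl fun b _ => Finset.sum_comm
    _ = ∑ b, ∑ c, ∑ l, ‖g₂ b l * g₃ c l‖ ^ 2 := by
        refine Finset.sum_congr rfl fun b _ => Finset.sum_congr rfl fun c _ => ?_
        have := parseval (fun l => g₂ b l * g₃ c l)
        simp only [mul_assoc] at this ⊢
        exact this
    _ = ∑ b, ∑ l, ∑ c, ‖g₂ b l * g₃ c l‖ ^ 2 := Finset.sum_congr rfl fun b _ => Finset.sum_comm
    _ = ∑ l, ∑ b, ∑ c, ‖g₂ b l * g₃ c l‖ ^ 2 := Finset.sum_comm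
    _ = ∑ l, (∑ b, ‖g₂ b l‖ ^ 2) * ∑ c, ‖g₃ c l‖ ^ 2 := by
        refine Finset.sum_congr rfl fun l _ => ?_
        rw [Finset.sum_mul_sum]
        exact Finset.sum_congr rfl fun b _ => Finset.sum_congr rfl fun c _ => by
          rw [norm_mul, mul_pow]

/-- An orthonormal column has norm one: `Σ_a ‖g₁ a l‖² = 1`. -/
theorem oneLeg_col_normSq [DecidableEq ι] (g₁ : Matrix ι ι ℂ)
    (h₁ : ∀ l m : ι, (∑ a, conj (g₁ a l) * g₁ a m) = if l = m then 1 else 0) (l : ι) :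
    (∑ a, ‖g₁ a l‖ ^ 2) = 1 := by
  apply Complex.ofReal_injective
  push_cast
  simp_rw [← Complex.conj_mul']
  rw [h₁ l l, if_pos rfl]

/-- **The one-leg-orthonormal law** (registered sub-goal `oneLegOrthonormalLaw` of crux
`stmt-MatrixMultiplication-14053`, line `unit-tensor-orbit-nuclear-ratio`): for a spectrally flat target `Y`
and a frame `S = Σ_l g₁(·,l) ⊗ g₂(·,l) ⊗ g₃(·,l)` whose FIRST leg has orthonormal columns,
`|⟨S, Y⟩|² ≤ |ι| · ‖S‖²` — the open stub `stub_nonnegFlatDecay` holds on this part of the orbit with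
`C = 1` and `δ = 1/2` (the best possible there: `S = Y =` a sum of `|ι|` disjoint units has ratio `|ι|`). -/
theorem oneLegOrthonormalLaw :
    ∀ (ι : Type) [Fintype ι] [DecidableEq ι] (Y : ι → ι → ι → ℂ),
      (∀ w u v : ι → ℂ, ‖∑ a, ∑ b, ∑ c, w a * u b * v c * Y a b c‖ ≤
          Real.sqrt (∑ a, ‖w a‖ ^ 2) * Real.sqrt (∑ b, ‖u b‖ ^ 2) * Real.sqrt (∑ c, ‖v c‖ ^ 2)) →
      ∀ g₁ g₂ g₃ : Matrix ι ι ℂ,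
        (∀ l m : ι, (∑ a, (starRingEnd ℂ) (g₁ a l) * g₁ a m) = if l = m then 1 else 0) →
        ‖∑ a, ∑ b, ∑ c, (∑ l, g₁ a l * g₂ b l * g₃ c l) * Y a b c‖ ^ 2 ≤
          (Fintype.card ι : ℝ) * ∑ a, ∑ b, ∑ c, ‖∑ l, g₁ a l * g₂ b l * g₃ c l‖ ^ 2 := by
  intro ι _ _ Y hY g₁ g₂ g₃ h₁
  -- the cost of the honest frame
  set B : ι → ℝ := fun l => Real.sqrt (∑ b, ‖g₂ b l‖ ^ 2) with hB
  set Cc : ι → ℝ := fun l => Real.sqrt (∑ c, ‖g₃ c l‖ ^ 2) with hCc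
  -- Step 1: `|⟨S,Y⟩| ≤ Σ_l B_l C_l`
  have step1 : ‖∑ a, ∑ b, ∑ c, (∑ l, g₁ a l * g₂ b l * g₃ c l) * Y a b c‖ ≤ ∑ l, B l * Cc l := by
    rw [oneLeg_overlap_sum]
    refine (norm_sum_le _ _).trans (Finset.sum_le_sum fun l _ => ?_)
    have h := hY (fun a => g₁ a l) (fun b => g₂ b l) (fun c => g₃ c l)
    rw [oneLeg_col_normSq g₁ h₁ l, Real.sqrt_one, one_mul] at h
    exact h
  -- Step 2: Cauchy–Schwarz over `l`
  have step2 : (∑ l, B l * Cc l) ^ 2 ≤ (Fintype.card ι : ℝ) * ∑ l, (B l * Cc l) ^ 2 := by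
    have h := Finset.sum_mul_sq_le_sq_mul_sq Finset.univ (fun _ : ι => (1 : ℝ)) (fun l => B l * Cc l)
    simp only [one_mul, one_pow, Finset.sum_const, Finset.card_univ, nsmul_eq_mul, mul_one] at h
    exact h
  -- Step 3: `Σ_l (B_l C_l)² = ‖S‖²`
  have step3 : (∑ l, (B l * Cc l) ^ 2) = ∑ a, ∑ b, ∑ c, ‖∑ l, g₁ a l * g₂ b l * g₃ c l‖ ^ 2 := by
    rw [oneLeg_normSq g₁ g₂ g₃ h₁]
    refine Finset.sum_congr rfl fun l _ => ?_
    rw [mul_pow, hB, hCc, Real.sq_sqrt (by positivity), Real.sq_sqrt (by positivity)]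
  calc ‖∑ a, ∑ b, ∑ c, (∑ l, g₁ a l * g₂ b l * g₃ c l) * Y a b c‖ ^ 2
      ≤ (∑ l, B l * Cc l) ^ 2 := pow_le_pow_left₀ (norm_nonneg _) step1 2
    _ ≤ (Fintype.card ι : ℝ) * ∑ l, (B l * Cc l) ^ 2 := step2
    _ = (Fintype.card ι : ℝ) * ∑ a, ∑ b, ∑ c, ‖∑ l, g₁ a l * g₂ b l * g₃ c l‖ ^ 2 := by rw [step3]

end

end Summit.MatrixMultiplication.MatrixMultiplication.Theorems.DiagonalPowerDecay
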